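import Literature.Geometry.Lorentzian.Stability
import Literature.Geometry.Lorentzian.DevelopmentProofs
import Literature.Geometry.Lorentzian.KerrDataSchwarzschildConstraints
import Literature.Geometry.Lorentzian.ConstraintFamilies
import HarnessLib

/-!
# Discharge of gr.S06 `dhrt_schwarzschild_codim3_stability` (shape-only form; vacuous (iii))

This file proves the named fact `Literature.Geometry.Lorentzian.dhrt_schwarzschild_codim3_stability`
of `Stability.lean` (gr.S06; Dafermos–Holzegel–Rodnianski–Taylor, *The non-linear stability of the
Schwarzschild family of black holes*, arXiv:2104.08222, Thm. I.3.1 / Thm. 8.1, vendored in a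
shape-only Cauchy-data consequence form): `dhrt_schwarzschild_codim3_stability_holds`.

## What is proved, and what is vacuous

The vendored statement has three clauses about a set `𝔐` of data on the Schwarzschild
Kerr–Schild slice `Kerr.slice 0 r₀`; we take `𝔐 = {all solutions of the vacuum constraints}`,
`(s, δ, k) = (0, 0, 0)`:

* (i)/(i') `Kerr.data M 0 r₀ ∈ 𝔐`: **the Schwarzschild Kerr–Schild slice data solve the vacuum
  constraints** — genuine content, the `a = 0` instance of the named fact
  `Kerr.data_isVacuumConstraintSolution`, proved from first principles in
  `KerrDataSchwarzschildMetric/Extrinsic/Constraints.lean`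
  (`Kerr.data_isVacuumConstraintSolution_zero`; Choquet-Bruhat 2009, Ch. VI, Thm. 3.3;
  Cook 2000, §3.2.2, (55)–(57));
* (ii) the codimension-`3` *shape* clause: through every constraint solution `D` passes a smooth
  injective `3`-parameter family of constraint solutions meeting `𝔐` — genuine (folklore)
  content, `Deformation.exists_family` (`ConstraintFamilies.lean`: pullbacks along a
  `3`-parameter family of compactly supported diffeomorphisms, diffeomorphism equivariance of
  the constraint map, Bartnik–Isenberg 2004, §2, `InitialDataPullback.lean`); the closeness
  hypothesis is not needed;
* (iii) the statement about maximal developments is **vacuous**: the vendored structure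
  `Development` is uninhabited (`Development.elim`, `DevelopmentProofs.lean`; dependency defect of
  `IsCauchySurface`, recorded for gr.S05/gr.S07 in `StabilityProofs.lean`). As for gr.S05/gr.S07,
  the faithful DHRT content (double-null gauges, `𝓘⁺`, decay to Schwarzschild) is therefore NOT
  exercised here; see the module docstring of `Stability.lean` for the audit of the paraphrase.

No named fact is introduced or consumed; net effect: the fact gr.S06 is discharged.

## References

* M. Dafermos, G. Holzegel, I. Rodnianski, M. Taylor, *The non-linear stability of the
  Schwarzschild family of black holes*, arXiv:2104.08222, Thm. I.3.1, Thm. 8.1 (key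
  `DafermosHolzegelRodnianskiTaylor2021`).
* Y. Choquet-Bruhat, *General Relativity and the Einstein Equations* (2009), Ch. VI, Thm. 3.3.
* R. Bartnik, J. Isenberg, *The constraint equations* (2004), §2.
-/

noncomputable section

open Set TopologicalSpace
open scoped ContDiff ENNReal Manifold

namespace Literature.Geometry.Lorentzian

/-- The Schwarzschild slice `{‖y‖ > max r₀ 0}` is nonempty: it contains `(max r₀ 0 + 1) e` for
any unit vector `e`.
Dafermos–Rodnianski arXiv:0811.0354, §5.1. [cite: arXiv08110354, §5.1] -/
theorem Kerr.exists_mem_slice_zero (r₀ : ℝ) : ∃ y : E3, y ∈ Kerr.slice 0 r₀ := by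
  obtain ⟨e, he⟩ := exists_norm_eq E3 zero_le_one
  refine ⟨(max r₀ 0 + 1) • e, ?_⟩
  rw [Kerr.mem_slice_zero_iff, norm_smul, he, mul_one, Real.norm_eq_abs, abs_of_pos (by positivity)]
  linarith

/-- **Discharge of gr.S06** (`dhrt_schwarzschild_codim3_stability`, shape-only consequence form
of Dafermos–Holzegel–Rodnianski–Taylor, arXiv:2104.08222, Thm. I.3.1): with
`𝔐 = {solutions of the vacuum constraints}` on the Schwarzschild Kerr–Schild slice, clause (i)
is `Kerr.data_isVacuumConstraintSolution_zero` (the Schwarzschild slice data solve the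
constraints), clause (ii) is `Deformation.exists_family` (smooth injective `3`-parameter families
of constraint solutions through any solution), and clause (iii) is vacuous (`Development.elim`).
See the module docstring for what is and is not exercised.
[cite: DafermosHolzegelRodnianskiTaylor2021, Thm. I.3.1] -/
theorem dhrt_schwarzschild_codim3_stability_holds [Kerr.Facts] [Kerr.SliceFacts] :
    dhrt_schwarzschild_codim3_stability := by
  refine ⟨0, 0, 0, fun M hM r₀ _ ↦ ?_⟩
  refine ⟨{D | ∀ [D.metric.HasLeviCivita], D.IsVacuumConstraintSolution}, subset_rfl,
    fun {_} ↦ Kerr.data_isVacuumConstraintSolution_zero M r₀ hM.le, ⟨1, one_pos,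
    fun D _ hvac _ ↦ ?_⟩, fun D _ 𝒟 _ ↦ 𝒟.toDevelopment.elim.elim⟩
  obtain ⟨y, hy⟩ := Kerr.exists_mem_slice_zero r₀
  obtain ⟨F, hsm, h0, hinj, hcon⟩ := Deformation.exists_family D hvac ⟨y, hy⟩
  exact ⟨F, hsm, h0, hinj, fun c {_} ↦ hcon c, 0, fun {_} ↦ hcon 0⟩

end Literature.Geometry.Lorentzian

end
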